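import Mathlib
import HarnessLib
import Summits.QuantumFields.YangMills.Theorems.HypercubicLimit.Negative.ReflectedDensity
import Summits.QuantumFields.YangMills.Theorems.FradkinShenkerFlowFiniteSusceptibilityWeakCouplingRPCauchySchwarz
import Literature.MathematicalPhysics.AQFT.OSAxiomsSchwinger
import Literature.MathematicalPhysics.QuantumFieldTheory.OSData
import Literature.MathematicalPhysics.QuantumFieldTheory.SchwingerLimitInheritance
import Literature.MathematicalPhysics.QuantumLattice.LatticeScalarField
import Literature.MathematicalPhysics.QuantumFieldTheory.LatticeGaugeStaticPotentialProofs
import Literature.Probability.LatticeModels.ThermodynamicLimit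

/-!
# Block GAP-inh: a mass gap is inherited along pointwise limits on `⁰𝒮`

Stub `rpBlock_gapInheritance` of line `conditional-mean-telescoping` (crux `stmt-QuantumFields-8646`,
c1 seat).  If `S j n F → T n F` for every off-diagonal `F` (`F ∈ ⁰𝒮ₙ`) and, for every pair of
time-ordered `F, G`, the OS-form clustering bound
`‖S j (ΘF* ⊗ T_t G) − S j (ΘF*) S j (G)‖ ≤ C e^{−Δt} + δ` holds eventually in `j` for every `δ > 0`
(with `C` depending on `F, G` only), then `T.toLabelled` has `HasMassGap Δ`.

Proof: every witness `H` of `ΘF* ⊗ T_t G` lies in `⁰𝒮`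
(`IsAppendTensorOf.isOffDiagonal_of_isTimeOrdered`, using that `T_t G` stays time-ordered for
`t ≥ 0`, `OSReconstructionNoE1.isTimeOrdered_translateMulti`), as do `ΘF*`
(`IsOffDiagonal.osAdjoint`) and `G`; hence the three sequences converge, the truncated quantity
converges in norm, the eventual bound passes to the limit (`le_of_tendsto`), and `δ > 0` is
arbitrary (`le_of_forall_pos_le_add`).
-/

noncomputable section

open scoped SchwartzMap ComplexConjugate
open MeasureTheory Filter Topology
open Literature.MathematicalPhysics.AQFT Literature.MathematicalPhysics.QuantumLattice
open Literature.MathematicalPhysics.QuantumFieldTheory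
open Literature.Probability.LatticeModels (box Site)
open Summit.QuantumFields.YangMills.Theorems.HypercubicLimit.Negative (torusPlaquette thetaZ)

namespace Summit.QuantumFields.YangMills.Cruxes.HypercubicLimit.ConditionalMeanTelescoping

/-- The limit step: if three sequences converge, `a j → a`, `b j → b`, `c j → c` (in `ℂ`), and
`‖a j - b j * c j‖ ≤ M + δ` eventually for every `δ > 0`, then `‖a - b * c‖ ≤ M`. [folklore] -/
theorem gapInh_norm_le_of_tendsto {a b c : ℕ → ℂ} {a₀ b₀ c₀ : ℂ} {M : ℝ}
    (ha : Tendsto a atTop (𝓝 a₀)) (hb : Tendsto b atTop (𝓝 b₀)) (hc : Tendsto c atTop (𝓝 c₀))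
    (h : ∀ δ : ℝ, 0 < δ → ∀ᶠ j in atTop, ‖a j - b j * c j‖ ≤ M + δ) :
    ‖a₀ - b₀ * c₀‖ ≤ M := by
  have hlim : Tendsto (fun j => ‖a j - b j * c j‖) atTop (𝓝 ‖a₀ - b₀ * c₀‖) :=
    (ha.sub (hb.mul hc)).norm
  exact le_of_forall_pos_le_add fun δ hδ => le_of_tendsto hlim (h δ hδ)

/-- **Block GAP-inh (a mass gap is inherited along pointwise limits on `⁰𝒮`).** If `S j → T` on
`⁰𝒮` and, for every pair of time-ordered `F, G`, the OS-form clustering bound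
`‖S j (ΘF* ⊗ T_t G) − S j (ΘF*) S j (G)‖ ≤ C e^{−Δt} + δ` holds eventually in `j` for every `δ > 0`
(the constant `C` depending on `F, G` only), then the limit family has `HasMassGap Δ`.
[cite: OsterwalderSchraderCMP1975, §4] -/
theorem rpBlock_gapInheritance :
    ∀ (d : ℕ) [NeZero d] (S : ℕ → SchwingerFamily (EuclideanSpace ℝ (Fin d)))
      (T : SchwingerFamily (EuclideanSpace ℝ (Fin d))) (Δ : ℝ),
      (∀ (n : ℕ) (F : 𝓢((Fin n → EuclideanSpace ℝ (Fin d)), ℂ)), IsOffDiagonal F →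
        Tendsto (fun j => S j n F) atTop (𝓝 (T n F))) →
      (∀ (n m : ℕ) (F : 𝓢((Fin n → EuclideanSpace ℝ (Fin d)), ℂ))
          (G : 𝓢((Fin m → EuclideanSpace ℝ (Fin d)), ℂ)), IsTimeOrdered F → IsTimeOrdered G →
        ∃ C : ℝ, ∀ t : ℝ, 0 ≤ t → ∀ H : 𝓢((Fin (n + m) → EuclideanSpace ℝ (Fin d)), ℂ),
          IsAppendTensorOf H (osAdjoint F) (translateMulti (EuclideanSpace.single 0 t) G) →
            ∀ δ : ℝ, 0 < δ → ∀ᶠ j in atTop,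
              ‖S j (n + m) H - S j n (osAdjoint F) * S j m G‖ ≤ C * Real.exp (-Δ * t) + δ) →
      (SchwingerFamily.toLabelled T).HasMassGap Δ := by
  intro d _ S T Δ hconv hclust n m k k' F G hF hG
  obtain ⟨C, hC⟩ := hclust n m F G hF hG
  refine ⟨C, fun t ht H hH => ?_⟩
  simp only [SchwingerFamily.toLabelled_apply]
  -- `T_t G` is time-ordered for `t ≥ 0`, so the witness `H` of `ΘF* ⊗ T_t G` lies in `⁰𝒮`
  have hGt : IsTimeOrdered (translateMulti (EuclideanSpace.single 0 t) G) :=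
    OSReconstructionNoE1.isTimeOrdered_translateMulti hG (by simp [ht])
  have hHo : IsOffDiagonal H := hH.isOffDiagonal_of_isTimeOrdered hF hGt
  exact gapInh_norm_le_of_tendsto (hconv (n + m) H hHo)
    (hconv n (osAdjoint F) hF.isOffDiagonal.osAdjoint) (hconv m G hG.isOffDiagonal)
    (hC t ht H hH)

end Summit.QuantumFields.YangMills.Cruxes.HypercubicLimit.ConditionalMeanTelescoping

end
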